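import Summits.QuantumFields.YangMills.Theorems.ParabolicTrajectoryTunedSequenceExistsSlackDefs
import Summits.QuantumFields.YangMills.Theorems.ParabolicTrajectoryTunedSequenceExistsQFemtoReduction

/-!
# Crux `TunedSequenceExists` (stmt-QuantumFields-10524): the core in CONTINUOUS INTRINSIC UNITS —
# (X) `SharpLowerBound`, with X ⇒ CORE (every `M`), X ∧ (A_in) ∧ (A_out) ⇒ the crux, X_Q ⇒ (S_Q) alone
# (lead c7, 2026-08-17; a route-level option for the planner, deliberately NOT a stub of the line)

Notation: `u(β, m, L) := (M^m)⁸ ⟨A ; τ_{M^m} A⟩_{β, 2L+1}` for an observable `A` (`P = r.curvature.F`, the corner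
action density of the crux as filed; `Q = spatialPlaquette r`, the time-zero plaquette of the RP-diagonal variant).

The crux core (`Negative.Glue.weak_iff_lowerBound`) is the `M`-adic, EXISTENTIAL finite-volume lower bound
`∃ θ₀ > 0, ∀ B m₀ L₀, ∃ m ≥ m₀, ∃ L ≥ L₀M^m, ∃ β ≥ B, θ₀ ≤ u(β, m, L)`.  Every believed proof strategy proves
more: a lower bound at ALL large couplings on ALL large tori once separations are measured in physical units.
This file types that uniform form,

  (X) `SharpLowerBound r A`: there are a CONTINUOUS unit map `a` (`a > 0`, `a → 0` at `+∞`), a physical band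
  `0 < s₁ ≤ s₂`, a height `ε > 0`, a coupling floor `β₅` and a physical-size floor `Λ₅` such that
  `ε ≤ D⁸ ⟨A ; τ_D A⟩_{β, 2L+1}` whenever `β ≥ β₅`, `a(β)·L ≥ Λ₅` and `s₁ ≤ D·a(β) ≤ s₂`

("in intrinsic units the rescaled temporal two-point function of `A` is bounded below at physical separations in a
fixed band, on every large torus, at every weak coupling" — Chatterjee's `ξ(β) → ∞` made quantitative with the
canonical amplitude; for `A = Q` it is a statement about ONE non-negative RP-diagonal covariance), and proves,
sorry-free:

* `exists_depth_coupling_on_level`: for `M ≥ 2` every physical level `s > 0` is hit EXACTLY, `M^m · a(β) = s`, beyond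
  any depth/coupling floors (IVT on the continuous unit map, `QFemto.exists_ge_unitMap_eq`) — the only analysis;
* `core_of_sharpLowerBound`: **X ⇒ CORE for every `M ≥ 2`** (so X replaces the PAIR (U) + (V) of the line
  `fixed-aspect-window`: no volume-comparison child is needed once the lower bound is typed in units);
* `femtoLowerBound_of_sharpLowerBound`: X ⇒ (U_∃h) `FixedAspectSplit.FemtoLowerBound` (consistency with the line);
* `tunedSequenceExists_of_sharp_subs` / `tunedSequenceExists_of_sharp_mirror_subs`: **X_P ∧ (A) ⇒ the crux**, resp.
  **X_P ∧ (A_in) ∧ (A_out) ⇒ the crux** (landed glue: exact tuning by IVT in β, mirror Cauchy–Schwarz, diagonal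
  extraction) — a THREE-child route-level split of (S) as filed;
* `tunedSequenceExistsQ_of_sharpQ`: **X_Q ⇒ (S_Q)** — for the time-zero plaquette the restated crux follows from X_Q
  ALONE (clause (iii) free by reflection positivity, `RPDiagonalVariant.windowQ_of_weak`): ONE child, no dependence on
  the sibling crux stmt-QuantumFields-16204 and no volume child (compare the c5/c6 recipe
  `QFemto.tunedSequenceExistsQ_of_femtoC_of_volumeSlack : FemtoCurvatureTwoPointC → VolumeMonotoneQSlackAll → (S_Q)`).

Why X is NOT registered as a stub: X ⇒ CORE, i.e. X is at least the core (by UNIFORMITY only — `∀ β, ∀ L` in place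
of `∃` — not by extra content such as boundary uniformity or conditional data, which is what killed the round-1
lines).  It is offered as the honest ATOMIC form of the open input (crux notes §14.2) in the vocabulary of the
sibling route `LangevinControlUV`, whose crux `OSLegsAtWeakCouplingC` (stmt-QuantumFields-16207) carries the SAME wall
internally: its non-triviality leg `DlrCollarTransfer.LowerBounds` (`…OSLegsFromFemtoAndGapDefs`, necessary for 16207)
is an infinite-volume lower bound `ε ≤ Q2_{β,L}(θv, v)` on the SMEARED action-density two-point function in units
`a` on all tori `a(β)·L ≥ Λ₅`, `β ≥ β₅` — X with a test function in place of the sharp lag.  Neither formally implies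
the other (existential `v`, general displacement vectors vs. the sharp temporal lag), but one engine proves both; a
planner may file X (or its all-displacement variant) as a child SHARED by (S) and 16207's NT leg.
Obligation pieces of our crux, deliberately untagged (not published facts).  Refs: Chatterjee, arXiv:1803.01950
Problem 5.1; Osterwalder–Seiler 1978 §2; Lüscher 1983/1986 (finite-size effects).
-/

noncomputable section

open Filter Topology MeasureTheory
open Literature.MathematicalPhysics.QuantumFieldTheory Literature.MathematicalPhysics.QuantumLattice

namespace Summit.QuantumFields.YangMills.Theorems.TunedSequenceExists.UnitsCore

/-! ## §1 The statement (X) at fixed data, for an arbitrary observable -/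

section Statements

variable {G : Type} [Group G] [TopologicalSpace G] [IsTopologicalGroup G] [CompactSpace G]
  [MeasurableSpace G] [BorelSpace G]

/-- **(X) Sharp infinite-volume lower bound in continuous intrinsic units.**  For the observable `A` under
Wilson's measure in the representation `r.ρ`: there are a continuous unit map `a : ℝ → ℝ` (`a β > 0`,
`a β → 0` as `β → +∞`), a physical band `0 < s₁ ≤ s₂`, a height `ε > 0` and floors `β₅, Λ₅` such that on every
odd torus of side `2L+1` with `a(β)·L ≥ Λ₅`, at every coupling `β ≥ β₅` and every lag `D` with
`s₁ ≤ D·a(β) ≤ s₂`, the rescaled temporal connected correlator satisfies `ε ≤ D⁸ ⟨A ; τ_D A⟩_{β, 2L+1}`.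
Obligation piece (uniform form of the crux core); not a published fact. -/
def SharpLowerBound (r : LatticeRep G) (A : LGConfig 4 G → ℝ) : Prop :=
  ∃ a : ℝ → ℝ, Continuous a ∧ (∀ β, 0 < a β) ∧ Tendsto a atTop (𝓝 0) ∧
    ∃ (s₁ s₂ ε β₅ Λ₅ : ℝ), 0 < s₁ ∧ s₁ ≤ s₂ ∧ 0 < ε ∧
      ∀ β : ℝ, β₅ ≤ β → ∀ (L D : ℕ), Λ₅ ≤ a β * L → s₁ ≤ D * a β → D * a β ≤ s₂ →
        ε ≤ (D : ℝ) ^ 8 * latticeConnectedCorr r.ρ β (2 * L + 1) A A D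

end Statements

/-- **(X_P) under the crux's quantifier prefix**: (X) for the corner action density `P = r.curvature.F` of the
crux as filed. -/
def SharpLowerBoundAll : Prop :=
  ∀ (G : Type) [Group G] [TopologicalSpace G] [IsTopologicalGroup G] [CompactSpace G],
    IsCompactSimpleLieGroup G → letI : MeasurableSpace G := borel G
    haveI : BorelSpace G := ⟨rfl⟩
    ∀ (r : LatticeRep G), SharpLowerBound r r.curvature.F

/-- **(X_Q) under the crux's quantifier prefix**: (X) for the time-zero plaquette `Q = spatialPlaquette r` of the
RP-diagonal variant (`RPDiagonalVariant.TunedSequenceExistsQ`). -/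
def SharpLowerBoundQAll : Prop :=
  ∀ (G : Type) [Group G] [TopologicalSpace G] [IsTopologicalGroup G] [CompactSpace G],
    IsCompactSimpleLieGroup G → letI : MeasurableSpace G := borel G
    haveI : BorelSpace G := ⟨rfl⟩
    ∀ (r : LatticeRep G), SharpLowerBound r (RPDiagonalVariant.spatialPlaquette r)

/-! ## §2 The one piece of analysis: every physical level is hit exactly at `M`-adic depths -/

section Level

/-- **Exact placement on a level of the unit map.**  For a continuous positive unit map `a → 0`, `M ≥ 2` and a
physical level `s > 0`: beyond every depth floor `m₀` and coupling floor `B` there are `m ≥ m₀` and `β ≥ B` with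
`M^m · a(β) = s` exactly (take `m` with `s / M^m ≤ a(B)`, then the intermediate value theorem on `[B, ∞)`).
[folklore] -/
theorem exists_depth_coupling_on_level {a : ℝ → ℝ} (ha : Continuous a) (hapos : ∀ β, 0 < a β)
    (hlim : Tendsto a atTop (𝓝 0)) {M : ℕ} (hM : 2 ≤ M) {s : ℝ} (hs : 0 < s) (B : ℝ) (m₀ : ℕ) :
    ∃ m : ℕ, m₀ ≤ m ∧ ∃ β : ℝ, B ≤ β ∧ (M : ℝ) ^ m * a β = s := by
  have hM1 : (1 : ℝ) < M := by exact_mod_cast hM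
  have hev : ∀ᶠ m : ℕ in atTop, s / a B ≤ (M : ℝ) ^ m :=
    (tendsto_pow_atTop_atTop_of_one_lt hM1).eventually (eventually_ge_atTop _)
  obtain ⟨m, hm⟩ := eventually_atTop.1 (hev.and (eventually_ge_atTop m₀))
  obtain ⟨hle, hm₀⟩ := hm m le_rfl
  have hMm : (0 : ℝ) < (M : ℝ) ^ m := by positivity
  have hs' : 0 < s / (M : ℝ) ^ m := by positivity
  have hsB : s / (M : ℝ) ^ m ≤ a B := by
    rw [div_le_iff₀ hMm]
    have := (div_le_iff₀ (hapos B)).1 hle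
    linarith [mul_comm (a B) ((M : ℝ) ^ m)]
  obtain ⟨β, hβ, hβs⟩ := QFemto.exists_ge_unitMap_eq ha hlim B hs' hsB
  refine ⟨m, hm₀, β, hβ, ?_⟩
  rw [hβs]
  field_simp

end Level

/-! ## §3 X ⇒ CORE (every `M ≥ 2`), X ⇒ (U_∃h) -/

section Core

variable {G : Type} [Group G] [TopologicalSpace G] [IsTopologicalGroup G] [CompactSpace G]
  [MeasurableSpace G] [BorelSpace G]

/-- Side arithmetic: with `a > 0`, the half-side `L := max L' ⌈Λ / a⌉₊` has physical size `a · L ≥ Λ`. -/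
theorem le_mul_max_ceil {a Λ : ℝ} (ha : 0 < a) (L' : ℕ) :
    Λ ≤ a * ((max L' ⌈Λ / a⌉₊ : ℕ) : ℝ) := by
  have h1 : Λ / a ≤ ((⌈Λ / a⌉₊ : ℕ) : ℝ) := Nat.le_ceil _
  have h2 : ((⌈Λ / a⌉₊ : ℕ) : ℝ) ≤ ((max L' ⌈Λ / a⌉₊ : ℕ) : ℝ) := by exact_mod_cast le_max_right _ _
  calc Λ = a * (Λ / a) := by field_simp
    _ ≤ a * ((max L' ⌈Λ / a⌉₊ : ℕ) : ℝ) := mul_le_mul_of_nonneg_left (h1.trans h2) ha.le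

/-- **X ⇒ CORE, for every `M ≥ 2`.**  The uniform units-form lower bound implies the crux core (the finite-volume
correlator window lower bound of `Negative.Glue.weak_iff_lowerBound`, here for an arbitrary observable `A`) with
`θ₀ = ε`: given floors `B, m₀, L₀`, place `M^m · a(β)` exactly on the level `s₂` beyond `max B β₅` and `m₀`
(`exists_depth_coupling_on_level`) and take the half-side `L = max (L₀ M^m) ⌈Λ₅ / a(β)⌉₊`. -/
theorem core_of_sharpLowerBound (r : LatticeRep G) (A : LGConfig 4 G → ℝ) {M : ℕ} (hM : 2 ≤ M)
    (h : SharpLowerBound r A) :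
    ∃ θ₀ : ℝ, 0 < θ₀ ∧ ∀ (B : ℝ) (m₀ L₀ : ℕ), ∃ m : ℕ, m₀ ≤ m ∧ ∃ L : ℕ, L₀ * M ^ m ≤ L ∧
      ∃ β : ℝ, B ≤ β ∧ θ₀ ≤ ((M : ℝ) ^ m) ^ 8 * latticeConnectedCorr r.ρ β (2 * L + 1) A A (M ^ m) := by
  obtain ⟨a, ha, hapos, hlim, s₁, s₂, ε, β₅, Λ₅, hs₁, hs₁₂, hε, h⟩ := h
  refine ⟨ε, hε, fun B m₀ L₀ => ?_⟩
  obtain ⟨m, hm₀, β, hβ, hlevel⟩ :=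
    exists_depth_coupling_on_level ha hapos hlim hM (hs₁.trans_le hs₁₂) (max B β₅) m₀
  refine ⟨m, hm₀, max (L₀ * M ^ m) ⌈Λ₅ / a β⌉₊, le_max_left _ _, β, (le_max_left _ _).trans hβ, ?_⟩
  have hD : ((M ^ m : ℕ) : ℝ) * a β = s₂ := by push_cast; exact hlevel
  have hstep := h β ((le_max_right _ _).trans hβ) (max (L₀ * M ^ m) ⌈Λ₅ / a β⌉₊) (M ^ m)
    (le_mul_max_ceil (hapos β) _) (by rw [hD]; exact hs₁₂) hD.le
  simpa only [Nat.cast_pow] using hstep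

/-- **X ⇒ (U_∃h).**  The units-form lower bound implies the pinned-aspect window `FixedAspectSplit.FemtoLowerBound`
of the line `fixed-aspect-window` for every `M ≥ 2`, with aspect floor `⌈Λ₅ / s₂⌉₊` and height `ε` at every
aspect: on the level `M^m · a(β) = s₂` the aspect-`L₁` torus has physical half-size `L₁ s₂ ≥ Λ₅`. -/
theorem femtoLowerBound_of_sharpLowerBound (r : LatticeRep G) {M : ℕ} (hM : 2 ≤ M)
    (h : SharpLowerBound r r.curvature.F) : FixedAspectSplit.FemtoLowerBound r M := by
  obtain ⟨a, ha, hapos, hlim, s₁, s₂, ε, β₅, Λ₅, hs₁, hs₁₂, hε, h⟩ := h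
  have hs₂ : 0 < s₂ := hs₁.trans_le hs₁₂
  refine ⟨⌈Λ₅ / s₂⌉₊, fun L₁ hL₁ => ⟨ε, hε, fun B m₀ => ?_⟩⟩
  obtain ⟨m, hm₀, β, hβ, hlevel⟩ := exists_depth_coupling_on_level ha hapos hlim hM hs₂ (max B β₅) m₀
  refine ⟨m, hm₀, β, (le_max_left _ _).trans hβ, ?_⟩
  have hD : ((M ^ m : ℕ) : ℝ) * a β = s₂ := by push_cast; exact hlevel
  have hΛ : Λ₅ ≤ a β * ((L₁ * M ^ m : ℕ) : ℝ) := by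
    have h1 : Λ₅ / s₂ ≤ (L₁ : ℝ) := (Nat.le_ceil _).trans (by exact_mod_cast hL₁)
    have h2 : Λ₅ ≤ (L₁ : ℝ) * s₂ := by rwa [div_le_iff₀ hs₂] at h1
    calc Λ₅ ≤ (L₁ : ℝ) * s₂ := h2
      _ = a β * ((L₁ * M ^ m : ℕ) : ℝ) := by rw [← hD]; push_cast; ring
  have hstep := h β ((le_max_right _ _).trans hβ) (L₁ * M ^ m) (M ^ m) hΛ (by rw [hD]; exact hs₁₂) hD.le
  simpa only [Nat.cast_pow] using hstep

/-- (X_P) ⇒ (U_∃h) under the crux prefix. -/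
theorem femtoLowerBoundAll_of_sharpLowerBoundAll (h : SharpLowerBoundAll) :
    FixedAspectSplit.FemtoLowerBoundAll := by
  intro G _ _ _ _ hG
  letI : MeasurableSpace G := borel G
  haveI : BorelSpace G := ⟨rfl⟩
  intro r M hM
  exact femtoLowerBound_of_sharpLowerBound r hM (h G hG r)

end Core

/-! ## §4 Glue: X_P ∧ (A) ⇒ the crux; X_P ∧ (A_in) ∧ (A_out) ⇒ the crux; X_Q ⇒ (S_Q) -/

section Glue

variable {G : Type} [Group G] [TopologicalSpace G] [IsTopologicalGroup G] [CompactSpace G]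
  [MeasurableSpace G] [BorelSpace G]

/-- **The crux body at fixed `(G, r, M)`, `M ≥ 2`, from X_P and (A)**: core (`core_of_sharpLowerBound`) ⇒ weak
window with EXACT tuning (landed `Negative.Glue.weak_of_lowerBound`: β-continuity + freezing + IVT) ⇒ a-priori bound
from (A) (`FixedAspectSplit.bounded_of_canonicalUpperBound`) ⇒ diagonal extraction
(`FixedAspectSplit.witness_of_bounded`). -/
theorem window_of_sharp_of_canonical (r : LatticeRep G) {M : ℕ} (hM : 2 ≤ M)
    (hX : SharpLowerBound r r.curvature.F) (hA : FixedAspectSplit.CanonicalUpperBound r) :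
    ∃ θ₀ : ℝ, 0 < θ₀ ∧ ∀ θ : ℝ, 0 < θ → θ < θ₀ →
      ∃ (sch : SpeciesScheme (YMSpecies G)) (n : ℕ → ℕ),
        (∀ k, sch.a k = ((M : ℝ) ^ n k)⁻¹) ∧ Tendsto sch.β atTop atTop ∧
        (∀ t : ℕ, 0 < t → ∃ c : ℝ, Tendsto (fun k => ((M : ℝ) ^ n k) ^ 8 *
            latticeConnectedCorr r.ρ (sch.β k) (sch.side k) r.curvature.F r.curvature.F
              (t * M ^ n k)) atTop (𝓝 c)) ∧
        Tendsto (fun k => ((M : ℝ) ^ n k) ^ 8 *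
            latticeConnectedCorr r.ρ (sch.β k) (sch.side k) r.curvature.F r.curvature.F
              (M ^ n k)) atTop (𝓝 θ) := by
  obtain ⟨θ₀, hθ₀, hweak⟩ :=
    Negative.Glue.weak_of_lowerBound r hM (core_of_sharpLowerBound r r.curvature.F hM hX)
  refine ⟨θ₀, hθ₀, fun θ hθ hθ' => ?_⟩
  obtain ⟨sch, n, hshape, hβ, hlim⟩ := hweak θ hθ hθ'
  exact FixedAspectSplit.witness_of_bounded r M θ sch n hshape hβ
    (fun t ht => FixedAspectSplit.bounded_of_canonicalUpperBound r hA sch n hshape hβ t ht) hlim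

end Glue

/-- **Two-child glue for (S) as filed**: `SharpLowerBoundAll → CanonicalUpperBoundAll →
Summit.QuantumFields.YangMills.Theses.ParabolicTrajectory.TunedSequenceExists` (sorry-free). -/
theorem tunedSequenceExists_of_sharp_subs (hX : SharpLowerBoundAll)
    (hA : FixedAspectSplit.CanonicalUpperBoundAll) :
    Summit.QuantumFields.YangMills.Theses.ParabolicTrajectory.TunedSequenceExists := by
  intro G _ _ _ _ hG
  letI : MeasurableSpace G := borel G
  haveI : BorelSpace G := ⟨rfl⟩
  intro r M hM
  exact window_of_sharp_of_canonical r hM (hX G hG r) (hA G hG r)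

/-- **Three-child glue for (S) as filed, mirror form** (the `--glue-by` declaration of the units option):
`SharpLowerBoundAll → MirrorBoundInAll → MirrorBoundOutAll →
Summit.QuantumFields.YangMills.Theses.ParabolicTrajectory.TunedSequenceExists` — (A_in) + (A_out) ⇒ (A) by the landed
odd-torus reflection positivity + Cauchy–Schwarz (`MirrorBound.canonicalUpperBoundAll_of_mirror`), then the
two-child glue. [cite: OsterwalderSeiler1978, §2] -/
theorem tunedSequenceExists_of_sharp_mirror_subs (hX : SharpLowerBoundAll)
    (hIn : FixedAspectSplit.MirrorBoundInAll) (hOut : FixedAspectSplit.MirrorBoundOutAll) :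
    Summit.QuantumFields.YangMills.Theses.ParabolicTrajectory.TunedSequenceExists :=
  tunedSequenceExists_of_sharp_subs hX (MirrorBound.canonicalUpperBoundAll_of_mirror hIn hOut)

/-- **One-child glue for the `Q`-restated crux**: `SharpLowerBoundQAll → RPDiagonalVariant.TunedSequenceExistsQ`
(sorry-free) — core for `Q` (`core_of_sharpLowerBound`) ⇒ exact tuning (`RPDiagonalVariant.weakQ_of_lowerBound`) ⇒
clause (iii) squeezed in `[0, N_1]` by reflection positivity (`RPDiagonalVariant.windowQ_of_weak`).  No upper-bound
child, no volume child, no sibling crux. [cite: OsterwalderSeiler1978, §2] -/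
theorem tunedSequenceExistsQ_of_sharpQ (hX : SharpLowerBoundQAll) :
    RPDiagonalVariant.TunedSequenceExistsQ := by
  intro G _ _ _ _ hG
  letI : MeasurableSpace G := borel G
  haveI : BorelSpace G := ⟨rfl⟩
  intro r M hM
  obtain ⟨θ₀, hθ₀, hweak⟩ := RPDiagonalVariant.weakQ_of_lowerBound r hM
    (core_of_sharpLowerBound r (RPDiagonalVariant.spatialPlaquette r) hM (hX G hG r))
  refine ⟨θ₀, hθ₀, fun θ hθ hθ' => ?_⟩
  obtain ⟨sch, n, hshape, hβ, hlim⟩ := hweak θ hθ hθ'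
  exact RPDiagonalVariant.windowQ_of_weak r M θ sch n hshape hβ hlim

/-- Consistency with the registered line: the units option feeds the line's own four-child glue through
`femtoLowerBoundAll_of_sharpLowerBoundAll` whenever a volume child is also granted (not needed: see
`tunedSequenceExists_of_sharp_mirror_subs`). -/
example (hX : SharpLowerBoundAll) (hV : FixedAspectSplit.VolumeMonotoneSlackAll)
    (hIn : FixedAspectSplit.MirrorBoundInAll) (hOut : FixedAspectSplit.MirrorBoundOutAll) :
    Summit.QuantumFields.YangMills.Theses.ParabolicTrajectory.TunedSequenceExists :=
  FixedAspectSplit.tunedSequenceExists_of_slack_mirror_subs (femtoLowerBoundAll_of_sharpLowerBoundAll hX) hV hIn hOut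

/-! ## §5 Size certificates (kernel-checked) -/

section Certificates

/-- Shape of (X) for an abstract rescaled table `u : ℝ → ℕ → ℕ → ℝ` (coupling, half-side, lag ↦ `D⁸⟨A;τ_D A⟩`)
and an abstract unit map. -/
def SharpLowerBoundShape (u : ℝ → ℕ → ℕ → ℝ) : Prop :=
  ∃ a : ℝ → ℝ, Continuous a ∧ (∀ β, 0 < a β) ∧ Tendsto a atTop (𝓝 0) ∧
    ∃ (s₁ s₂ ε β₅ Λ₅ : ℝ), 0 < s₁ ∧ s₁ ≤ s₂ ∧ 0 < ε ∧
      ∀ β : ℝ, β₅ ≤ β → ∀ (L D : ℕ), Λ₅ ≤ a β * L → s₁ ≤ D * a β → D * a β ≤ s₂ → ε ≤ u β L D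

/-- (X) at fixed data IS its shape applied to Wilson's rescaled correlator table (definitional). -/
theorem sharpLowerBound_iff_shape {G : Type} [Group G] [TopologicalSpace G] [IsTopologicalGroup G]
    [CompactSpace G] [MeasurableSpace G] [BorelSpace G] (r : LatticeRep G) (A : LGConfig 4 G → ℝ) :
    SharpLowerBound r A ↔
      SharpLowerBoundShape (fun β L D => (D : ℝ) ^ 8 * latticeConnectedCorr r.ρ β (2 * L + 1) A A D) :=
  Iff.rfl

/-- **(X) is not inhabited by the zero table** (it has lower-bound content, unlike (V_slack), (A_in), (A_out)). -/
theorem not_sharpLowerBoundShape_zero : ¬ SharpLowerBoundShape (fun _ _ _ => 0) := by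
  rintro ⟨a, ha, hapos, hlim, s₁, s₂, ε, β₅, Λ₅, hs₁, hs₁₂, hε, h⟩
  -- place the lag `2^m` on the level `s₂` beyond `β₅`, with a torus of physical size `≥ Λ₅`
  obtain ⟨m, -, β, hβ, hlevel⟩ :=
    exists_depth_coupling_on_level (M := 2) ha hapos hlim le_rfl (hs₁.trans_le hs₁₂) β₅ 0
  have hD : ((2 ^ m : ℕ) : ℝ) * a β = s₂ := by push_cast; exact hlevel
  have := h β hβ (max 0 ⌈Λ₅ / a β⌉₊) (2 ^ m) (le_mul_max_ceil (hapos β) 0) (by rw [hD]; exact hs₁₂) hD.le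
  exact absurd this (not_le.2 hε)

/-- **(X) is inhabited by the unit table** `u ≡ 1` with ANY continuous positive unit map tending to `0`
(e.g. `a β = e^{−β}`): the statement constrains only the size of the rescaled correlator in a band, nothing
else — in particular it carries no clustering, no uniqueness and no continuum-limit claim. -/
theorem sharpLowerBoundShape_one : SharpLowerBoundShape (fun _ _ _ => 1) :=
  ⟨fun β => Real.exp (-β), by fun_prop, fun β => Real.exp_pos _, Real.tendsto_exp_neg_atTop_nhds_zero,
    1, 1, 1, 0, 0, one_pos, le_rfl, one_pos, fun _ _ _ _ _ _ _ => le_rfl⟩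

end Certificates

end Summit.QuantumFields.YangMills.Theorems.TunedSequenceExists.UnitsCore

end
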